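import Summits.QuantumFields.YangMills.Theorems.BalabanUVNodesN21GappedRoadK3V6Knit
import Summits.QuantumFields.YangMills.Theorems.BalabanUVNodesN21GappedRoadRStepNeutral
import Summits.QuantumFields.YangMills.Theorems.BalabanUVNodesN21GappedTopCutDials
import Summits.QuantumFields.YangMills.Theorems.BalabanUVNodesN20GappedRoadCutZeroKnit

/-!
# N21 (NE7c) · K3⁸ ON THE GAPPED ROAD WITH THE DIALS PRODUCED FROM ONE CLOSENESS LETTER — the consumer's END-TO-END of dag-n21-d's
# `spineGivenEndpointR13SepCoPHV_of_gapRoad`: the width ∕ depth letters `ρ, n` and their rows are no longer free data but ∃-produced inside the proof from ONE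
# relative two-run closeness letter `δc` (`0 ≤ δc ≤ 1∕16`, `Σ_K δc < ∞` per tuple); N19′ (and N20) are asked for their witnesses at EVERY dial pair compatible with
# `δc`; in the RECORD edition N20 is read dial-free at dag-n20-d's record weights `weightA₁₃ ∕ weightB₁₃` (dag-n21-d V4)

Track A of `YM-PLAN.md` (cell `pub-ymgap`), node **N21** (NE7c, NOT PRINTED); WIDTH SEAT `pub-ymgap-dag-n21-w2` (gen 4), file 13.  THEOREMS ONLY: 0 `def`, 0 `sorry`;
COUNT-NEUTRAL; `--kind proof --supports stmt-QuantumFields-27366 --as helper` (K3⁸ `SpineGivenEndpointR13SepCoPHV`, dag-lead KEY MAP v2).  Imports BY NAME: dag-n21-d g12's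
V1 `…N21GappedRoadK3V6Knit` (p629674: `spineGivenEndpointR13SepCoPHV_of_gapRoad ∕ _of_gapPin`, `exists_reading_livePin`, `keyedShellWeight_of_gapPin`,
`keyedExtractionV_of_gapPin`, `keyedRelWeight_of_gapPin_of_witness`, `keyedCoreEdgeHolderD4V_of_gapPin_of_witness`) and V4 `…N21GappedRoadRStepNeutral` (p632312:
`relWeightBound_gapCarriers_iff_record`), this seat's g3 file 2 `…N21GappedTopCutDials` (p623041: `exists_widthDepthLetters_of_summable`), and dag-n20-w2's `…N20GappedRoadCutZeroKnit` (p635103: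
`spineGivenEndpointR13SepCoPHV_of_gapRoad_cutZero`, N20's witness DISCHARGED at the zero cut `jc ≡ 0`).  No new Theses import (V1 already concludes the route decl BY
NAME); restates nothing.

WHY.  V1's pin-free knit `spineGivenEndpointR13SepCoPHV_of_gapRoad β rr jc ρ n …` displays the dial letters `ρ : WidthLetter₁₃CoPH 2`, `n : DepthLetter₁₃CoPH 2` with the rows
`0 ≤ ρ ≤ 1`, `Σ_K 1∕(n_K+1) < ∞`, and asks N20 ∕ N19′ for witnesses at the gapped carriers ∕ cores AT THOSE dials; its docstring names this seat's `exists_dials_of_summable` as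
the dials' producer.  On the consumer's side (this seat's g3 junction, files 1∕3∕5∕11: design (i)'s common-refinement deficit ≤ the gapped deficit) the dials are NOT free: they
must clear N16's two-run closeness at the (2.17) scale, `Δ_K = ε·δc_K`, on both sides of the selected collar — the six COMPATIBILITY ROWS `0 ≤ ρ ≤ 1`, `Σ 1∕(n+1) < ∞`,
`2δc ≤ ρ`, `(1−ρ)^{n+2} ≥ 1∕2`, `δc ≤ (1−ρ)^i ρ (i ≤ n+2)` — and such dials EXIST for every closeness letter with `0 ≤ δc ≤ 1∕16`, `Σ δc < ∞` (file 2).  THIS FILE closes that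
loop at the item level: ONE closeness letter in, K3⁸ out, with N19′'s (and N20's) witness binders quantified over EVERY compatible local dial pair `(ρ, n) : (ℕ → ℝ) × (ℕ → ℕ)` per
tuple (the shape a supplier working through the junction meets), K4 ∕ node U5's Target ∕ (H-ζ) verbatim.  The RECORD edition reads N20's witness where stub 2's v6 text reads it —
at dag-n20-d's record weights — through V4's `RelWeightBound (gapWeight…) ↔ RelWeightBound (weight…)` (the top 𝐑-step is weight-neutral on the live line), at the price of ONE
displayed row: the cut reading's persistence policy `jc … K < K ∨ jc … K = 0` (V2∕V4's `hj`).

WHAT IS PROVED (kernel; [bookkeeping] throughout — pure logic over the named theorems; NO estimate).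
§1 `dialRows_of_compat` (projection of the compatibility rows onto V1's dial rows) · ★★★ `spineGivenEndpointR13SepCoPHV_of_gapRoad_of_closeness` · ★★★
   `spineGivenEndpointR13SepCoPHV_of_gapRoad_of_closeness_record` (N20 at the record weights, + policy row) · ★★ `exists_gapPinned_faces_of_closeness` (from `δc` + the
   ∀-compatible-dials witnesses: ∃ letters `(ρ, n)` COMPATIBLE with `δc` at every tuple and ∃ a reading pinned to `crGap₁₃V 2 (jc …) ρ n` on the live line ∕ `crOneTerm₁₃ 0` off
   it carrying ALL FOUR K5 faces — N21's and N27x's by V1's theorems) · ★★ `exists_gapPinned_faces_of_closeness_record`.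
§3 ★★★ `spineGivenEndpointR13SepCoPHV_of_gapRoad_of_closeness_cutZero` — the FEWEST-BINDER edition: at the zero cut `jc ≡ 0` N20's line is dag-n20-w2's THEOREM, so K3⁸
   follows from (H-ζ) + ONE closeness letter + K4 + N19′'s all-classes NE7 sandwich between the two runs' gapped cores (∀ compatible dials, under the prefix) + Target.

HONEST FRAMING (binding).  Bookkeeping BY NAME; NO estimate of Bałaban's asserted or used; the closeness letter `δc` (N16's two-run closeness of the (2.17) statistics at the
indicator's scale, NOT PRINTED), K4, N20's and N19′'s witnesses, node U5's Target and (H-ζ) are DISPLAYED HYPOTHESES inhabited for no family today (K0⁷ `Record13SepCoPHInhabited`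
OPEN); NE7 ∕ NE7b ∕ NE7c NOT PRINTED for `d = 4`; NE7c at print's FIXED thresholds NOT proved (the discharged N21 face is V1's (M1)-free one at SELECTED relative letters); this
is NOT `stub_expansion13HV` (its `PinnedAtLive` names `crOfRecord₁₃V`, untouched); **N21 NOT discharged**; K3⁸ NOT claimed (v6 0∕2); counts UNMOVED (typed 28∕28 · discharged
5∕27); never a count claim.  No `sorry`, no `def`, no `instance`, no `notation`; standard axioms.  One finite four-torus programme at fixed `ε` — NOT ℝ⁴, NOT OS, NOT a mass gap,
NOT the Clay problem.  No decl below carries a cite tag.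
-/

set_option autoImplicit false

noncomputable section

open scoped BigOperators

namespace Summit.QuantumFields.YangMills.Theorems.N21GappedRoadK3V6KnitOfCloseness

open Literature.MathematicalPhysics.QuantumFieldTheory.Balaban1983to89
open Literature.MathematicalPhysics.QuantumFieldTheory.Balaban1983to89.T4Continuum
open Literature.MathematicalPhysics.QuantumFieldTheory.Balaban1983to89.Node00
open T4WeightBudget (RelWeightBound)
open T4ContinuumYM4Torus (ForSmallCouplings)
open Summit.QuantumFields.BalabanUV.T4Continuum.Spine
open YMDAG.UVSplit (classSet₁₃ badClass₁₃ weightA₁₃ weightB₁₃)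
open Summit.QuantumFields.YangMills.Theorems.K3V5Defs (SpineReading RateReadingFn CutReading KeyedRelWeight KeyedShellWeight LiveSel PHolderD4)
open Summit.QuantumFields.YangMills.Theorems.K3V6Defs (KeyedRatesHolderD4V KeyedCoreEdgeHolderD4V KeyedExtractionV)
open Summit.QuantumFields.YangMills.BalabanUVNodes.N20OffLiveOneTermReading (crOneTerm₁₃)
open Summit.QuantumFields.YangMills.Theorems.N21ShellSplitOfRecord13CoPH (WidthLetter₁₃CoPH DepthLetter₁₃CoPH crGap₁₃V gapWeightA₁₃ gapWeightB₁₃ gapCoreA₁₃ gapCoreB₁₃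
  relWeightBound_gapCarriers_iff_record)
open Summit.QuantumFields.YangMills.Theorems.N21GappedTopCutDials (exists_widthDepthLetters_of_summable)
open Summit.QuantumFields.YangMills.BalabanUVNodes.N20GappedRoadCutZeroKnit (spineGivenEndpointR13SepCoPHV_of_gapRoad_cutZero)
open Summit.QuantumFields.YangMills.Theorems.N21GappedRoadK3V6Knit (exists_reading_livePin spineGivenEndpointR13SepCoPHV_of_gapRoad keyedShellWeight_of_gapPin
  keyedExtractionV_of_gapPin keyedRelWeight_of_gapPin_of_witness keyedCoreEdgeHolderD4V_of_gapPin_of_witness)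

/-! ## §1 One closeness letter in, K3⁸ out -/

/-- Bookkeeping projection: the six compatibility rows of a local dial pair `(ρ, n)` w.r.t. a closeness sequence `d` contain V1's two dial rows `0 ≤ ρ_K ≤ 1`,
`Σ_K 1∕(n_K+1) < ∞`. [bookkeeping] -/
theorem dialRows_of_compat {d ρ : ℕ → ℝ} {n : ℕ → ℕ}
    (h : (∀ K, 0 ≤ ρ K) ∧ (∀ K, ρ K ≤ 1) ∧ Summable (fun K => 1 / ((n K : ℝ) + 1)) ∧ (∀ K, 2 * d K ≤ ρ K) ∧ (∀ K, (1 : ℝ) / 2 ≤ (1 - ρ K) ^ (n K + 2)) ∧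
      (∀ K i, i ≤ n K + 2 → d K ≤ (1 - ρ K) ^ i * ρ K)) :
    (∀ K, 0 ≤ ρ K ∧ ρ K ≤ 1) ∧ Summable (fun K => 1 / ((n K : ℝ) + 1)) :=
  ⟨fun K => ⟨h.1 K, h.2.1 K⟩, h.2.2.1⟩

/-- ★★★ **K3⁸ ON THE GAPPED ROAD FROM ONE CLOSENESS LETTER.**  Displayed, binder by binder: (H-ζ) `ZetaMeasurable` on the guarded admissible tuples of the live-selector line;
ONE relative closeness letter `δc` with `0 ≤ δc ≤ 1∕16` and `Σ_K δc_K < ∞` at every tuple (N16's two-run closeness at the (2.17) scale in units of `ε`; NOT PRINTED); K4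
`KeyedRatesHolderD4V β rr`; N20's WITNESS at the gapped carriers on the live line FOR EVERY local dial pair `(ρ, n)` compatible with `δc` at the tuple; N19′'s WITNESS at the
gapped cores on the live line likewise (slot-keyed, under (B) → END → `ForSmallCouplings` at the slot datum and `PHolderD4 β`); node U5's Target off the live line.  The dials
are minted inside the proof (this seat's `exists_widthDepthLetters_of_summable`) and handed to V1's `spineGivenEndpointR13SepCoPHV_of_gapRoad`.  Every displayed binder is a
HYPOTHESIS inhabited for no family today (K0⁷ OPEN); NE7 ∕ NE7b ∕ NE7c NOT PRINTED for `d = 4`; N21 NOT discharged by this; K3⁸ NOT claimed. [bookkeeping] -/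
theorem spineGivenEndpointR13SepCoPHV_of_gapRoad_of_closeness (β : ℝ) (rr : RateReadingFn) (jc : CutReading) (δc : WidthLetter₁₃CoPH 2)
    (hζm : ∀ (F : T4Family) (θ : Stage13HParams F 2), θ.Provisos₁₃CoPH F 2 → ((θ.ZhUnity F 2 ∧ θ.SlotsNondegenerate₁₃ F 2) ∧ LiveSel F θ) → θ.Admissible F 2 →
      ZetaMeasurable F 2 θ.ζ)
    (h0 : ∀ (F : T4Family) (θ : Stage13HParams F 2) (hP : θ.Provisos₁₃CoPH F 2) (g₀ : ℕ → ℝ) (os : List (ULoop F)) (K : ℕ), 0 ≤ δc F θ hP g₀ os K)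
    (h16 : ∀ (F : T4Family) (θ : Stage13HParams F 2) (hP : θ.Provisos₁₃CoPH F 2) (g₀ : ℕ → ℝ) (os : List (ULoop F)) (K : ℕ), δc F θ hP g₀ os K ≤ 1 / 16)
    (hs : ∀ (F : T4Family) (θ : Stage13HParams F 2) (hP : θ.Provisos₁₃CoPH F 2) (g₀ : ℕ → ℝ) (os : List (ULoop F)), Summable (δc F θ hP g₀ os))
    (hr : KeyedRatesHolderD4V β rr)
    (h20 : ∀ (F : T4Family) (θ : Stage13HParams F 2) (hP : θ.Provisos₁₃CoPH F 2), ((θ.ZhUnity F 2 ∧ θ.SlotsNondegenerate₁₃ F 2) ∧ LiveSel F θ) → θ.Admissible F 2 →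
      ∀ (g₀ : ℕ → ℝ) (os : List (ULoop F)) (ρ : ℕ → ℝ) (n : ℕ → ℕ),
        (∀ K, 0 ≤ ρ K) ∧ (∀ K, ρ K ≤ 1) ∧ Summable (fun K => 1 / ((n K : ℝ) + 1)) ∧ (∀ K, 2 * δc F θ hP g₀ os K ≤ ρ K) ∧
          (∀ K, (1 : ℝ) / 2 ≤ (1 - ρ K) ^ (n K + 2)) ∧ (∀ K i, i ≤ n K + 2 → δc F θ hP g₀ os K ≤ (1 - ρ K) ^ i * ρ K) →
        ∃ W : ℕ → ℝ, RelWeightBound 1 (classSet₁₃ θ 0 g₀) (gapWeightA₁₃ θ hP 0 g₀ os ρ n) (gapWeightB₁₃ θ hP 0 g₀ os ρ n) (badClass₁₃ θ 0 g₀ (jc F θ hP g₀ os)) W)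
    (h19 : ∀ (F : T4Family) (θ : Stage13HParams F 2) (h : θ.Provisos₁₃SepCoPH F 2) (v : Revision₁₃ F 2 θ h),
      ((θ.ZhUnity F 2 ∧ θ.SlotsNondegenerate₁₃ F 2) ∧ LiveSel F θ) → θ.Admissible F 2 →
      B16.EndStatementBPrinted (datumOfRecord₁₃SepCoPHV F 2 θ h v).C → DagBinding.EndpointExistence (datumOfRecord₁₃SepCoPHV F 2 θ h v).C.toB12 →
        ForSmallCouplings (datumOfRecord₁₃SepCoPHV F 2 θ h v) fun g₀ => ∀ (os : List (ULoop F)) (ρ : ℕ → ℝ) (n : ℕ → ℕ),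
          (∀ K, 0 ≤ ρ K) ∧ (∀ K, ρ K ≤ 1) ∧ Summable (fun K => 1 / ((n K : ℝ) + 1)) ∧ (∀ K, 2 * δc F θ h.toCore g₀ os K ≤ ρ K) ∧
            (∀ K, (1 : ℝ) / 2 ≤ (1 - ρ K) ^ (n K + 2)) ∧ (∀ K i, i ≤ n K + 2 → δc F θ h.toCore g₀ os K ≤ (1 - ρ K) ^ i * ρ K) →
          PHolderD4 β (datumOfRecord₁₃SepCoPHV F 2 θ h v) (rr F θ h.toCore g₀ os) →
            letI : DecidableEq (Σ K, SiteSeqKey F (0 + K)) := Classical.decEq _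
            ∃ δ : ℕ → ℝ, NE7.Core 1 (F.side ^ 4) (classSet₁₃ θ 0 g₀) (badClass₁₃ θ 0 g₀ (jc F θ h.toCore g₀ os))
              (gapCoreA₁₃ θ h.toCore 0 g₀ os ρ n) (gapCoreB₁₃ θ h.toCore 0 g₀ os ρ n) δ ∧ Summable δ)
    (htarget : ∀ (F : T4Family) (θ : Stage13HParams F 2) (hP : θ.Provisos₁₃CoPH F 2), ((θ.ZhUnity F 2 ∧ θ.SlotsNondegenerate₁₃ F 2) ∧ ¬ LiveSel F θ) → θ.Admissible F 2 →
      ∀ (g₀ : ℕ → ℝ) (os : List (ULoop F)), PHolderD4 β (datumOfRecord₁₃CoPH F 2 θ hP) (rr F θ hP g₀ os) →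
        ∃ δ : ℕ → ℝ, NE7.Target ((F.side : ℝ) ^ 4) 1 δ (fun K => T4GenFunBounds.schemeZ ((datumOfRecord₁₃CoPH F 2 θ hP).scheme g₀) os (0 + K))) :
    Summit.QuantumFields.YangMills.Theses.BalabanUVNodes.SpineGivenEndpointR13SepCoPHV := by
  obtain ⟨ρ, n, hc⟩ := exists_widthDepthLetters_of_summable (N := 2) δc h0 h16 hs
  refine spineGivenEndpointR13SepCoPHV_of_gapRoad β rr jc ρ n hζm (fun F θ hP g₀ os => (dialRows_of_compat (hc F θ hP g₀ os)).1)
    (fun F θ hP g₀ os => (dialRows_of_compat (hc F θ hP g₀ os)).2) hr (fun F θ hP hG hθ g₀ os => h20 F θ hP hG hθ g₀ os _ _ (hc F θ hP g₀ os))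
    (fun F θ h v hG hθ hB hE => ?_) htarget
  exact ForSmallCouplings.mono (fun g₀ h' os hPr => h' os _ _ (hc F θ h.toCore g₀ os) hPr) (h19 F θ h v hG hθ hB hE)

/-- ★★★ **K3⁸ ON THE GAPPED ROAD FROM ONE CLOSENESS LETTER — N20 READ AT THE RECORD.**  As `spineGivenEndpointR13SepCoPHV_of_gapRoad_of_closeness`, but N20's witness is asked
DIAL-FREE where stub 2's v6 text reads it: `∃ W, RelWeightBound 1 (classSet₁₃ θ 0 g₀) (weightA₁₃ θ hP 0 g₀ os) (weightB₁₃ θ hP 0 g₀ os) (badClass₁₃ θ 0 g₀ (jc …)) W` at dag-n20-d's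
record weights on the live line, transferred to the gapped carriers by dag-n21-d V4's `relWeightBound_gapCarriers_iff_record` (the top 𝐑-step is weight-neutral per history on the
live line) — one more displayed row: the cut reading's persistence policy `jc … K < K ∨ jc … K = 0` (V2∕V4's `hj`, with `K₀ = 0`).  Every displayed binder a HYPOTHESIS; nothing
of Bałaban's proved; K3⁸ NOT claimed. [bookkeeping] -/
theorem spineGivenEndpointR13SepCoPHV_of_gapRoad_of_closeness_record (β : ℝ) (rr : RateReadingFn) (jc : CutReading) (δc : WidthLetter₁₃CoPH 2)
    (hζm : ∀ (F : T4Family) (θ : Stage13HParams F 2), θ.Provisos₁₃CoPH F 2 → ((θ.ZhUnity F 2 ∧ θ.SlotsNondegenerate₁₃ F 2) ∧ LiveSel F θ) → θ.Admissible F 2 →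
      ZetaMeasurable F 2 θ.ζ)
    (h0 : ∀ (F : T4Family) (θ : Stage13HParams F 2) (hP : θ.Provisos₁₃CoPH F 2) (g₀ : ℕ → ℝ) (os : List (ULoop F)) (K : ℕ), 0 ≤ δc F θ hP g₀ os K)
    (h16 : ∀ (F : T4Family) (θ : Stage13HParams F 2) (hP : θ.Provisos₁₃CoPH F 2) (g₀ : ℕ → ℝ) (os : List (ULoop F)) (K : ℕ), δc F θ hP g₀ os K ≤ 1 / 16)
    (hs : ∀ (F : T4Family) (θ : Stage13HParams F 2) (hP : θ.Provisos₁₃CoPH F 2) (g₀ : ℕ → ℝ) (os : List (ULoop F)), Summable (δc F θ hP g₀ os))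
    (hj : ∀ (F : T4Family) (θ : Stage13HParams F 2) (hP : θ.Provisos₁₃CoPH F 2) (g₀ : ℕ → ℝ) (os : List (ULoop F)) (K : ℕ),
      jc F θ hP g₀ os K < 0 + K ∨ jc F θ hP g₀ os K = 0)
    (hr : KeyedRatesHolderD4V β rr)
    (h20 : ∀ (F : T4Family) (θ : Stage13HParams F 2) (hP : θ.Provisos₁₃CoPH F 2), ((θ.ZhUnity F 2 ∧ θ.SlotsNondegenerate₁₃ F 2) ∧ LiveSel F θ) → θ.Admissible F 2 →
      ∀ (g₀ : ℕ → ℝ) (os : List (ULoop F)),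
        ∃ W : ℕ → ℝ, RelWeightBound 1 (classSet₁₃ θ 0 g₀) (weightA₁₃ θ hP 0 g₀ os) (weightB₁₃ θ hP 0 g₀ os) (badClass₁₃ θ 0 g₀ (jc F θ hP g₀ os)) W)
    (h19 : ∀ (F : T4Family) (θ : Stage13HParams F 2) (h : θ.Provisos₁₃SepCoPH F 2) (v : Revision₁₃ F 2 θ h),
      ((θ.ZhUnity F 2 ∧ θ.SlotsNondegenerate₁₃ F 2) ∧ LiveSel F θ) → θ.Admissible F 2 →
      B16.EndStatementBPrinted (datumOfRecord₁₃SepCoPHV F 2 θ h v).C → DagBinding.EndpointExistence (datumOfRecord₁₃SepCoPHV F 2 θ h v).C.toB12 →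
        ForSmallCouplings (datumOfRecord₁₃SepCoPHV F 2 θ h v) fun g₀ => ∀ (os : List (ULoop F)) (ρ : ℕ → ℝ) (n : ℕ → ℕ),
          (∀ K, 0 ≤ ρ K) ∧ (∀ K, ρ K ≤ 1) ∧ Summable (fun K => 1 / ((n K : ℝ) + 1)) ∧ (∀ K, 2 * δc F θ h.toCore g₀ os K ≤ ρ K) ∧
            (∀ K, (1 : ℝ) / 2 ≤ (1 - ρ K) ^ (n K + 2)) ∧ (∀ K i, i ≤ n K + 2 → δc F θ h.toCore g₀ os K ≤ (1 - ρ K) ^ i * ρ K) →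
          PHolderD4 β (datumOfRecord₁₃SepCoPHV F 2 θ h v) (rr F θ h.toCore g₀ os) →
            letI : DecidableEq (Σ K, SiteSeqKey F (0 + K)) := Classical.decEq _
            ∃ δ : ℕ → ℝ, NE7.Core 1 (F.side ^ 4) (classSet₁₃ θ 0 g₀) (badClass₁₃ θ 0 g₀ (jc F θ h.toCore g₀ os))
              (gapCoreA₁₃ θ h.toCore 0 g₀ os ρ n) (gapCoreB₁₃ θ h.toCore 0 g₀ os ρ n) δ ∧ Summable δ)
    (htarget : ∀ (F : T4Family) (θ : Stage13HParams F 2) (hP : θ.Provisos₁₃CoPH F 2), ((θ.ZhUnity F 2 ∧ θ.SlotsNondegenerate₁₃ F 2) ∧ ¬ LiveSel F θ) → θ.Admissible F 2 →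
      ∀ (g₀ : ℕ → ℝ) (os : List (ULoop F)), PHolderD4 β (datumOfRecord₁₃CoPH F 2 θ hP) (rr F θ hP g₀ os) →
        ∃ δ : ℕ → ℝ, NE7.Target ((F.side : ℝ) ^ 4) 1 δ (fun K => T4GenFunBounds.schemeZ ((datumOfRecord₁₃CoPH F 2 θ hP).scheme g₀) os (0 + K))) :
    Summit.QuantumFields.YangMills.Theses.BalabanUVNodes.SpineGivenEndpointR13SepCoPHV := by
  refine spineGivenEndpointR13SepCoPHV_of_gapRoad_of_closeness β rr jc δc hζm h0 h16 hs hr (fun F θ hP hG hθ g₀ os ρ n _ => ?_) h19 htarget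
  obtain ⟨W, hW⟩ := h20 F θ hP hG hθ g₀ os
  exact ⟨W, (relWeightBound_gapCarriers_iff_record 0 θ hP g₀ os (EOfRecord₁₃ F 2 θ.toStage13Params) hG.2 (hζm F θ hP hG hθ) (jc F θ hP g₀ os)
    (hj F θ hP g₀ os) ρ n W).2 hW⟩

/-! ## §2 What stub 2 would read under a gap pin, from one closeness letter -/

/-- ★★ **A GAP-PINNED READING WITH ALL FOUR K5 FACES, FROM ONE CLOSENESS LETTER.**  From `δc` (rows `0 ≤ δc ≤ 1∕16`, `Σ δc < ∞`), (H-ζ) on the live line, N20's and N19′'s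
witnesses at the gapped objects FOR EVERY compatible local dial pair, and node U5's Target off the live line: there are letters `(ρ, n)` COMPATIBLE with `δc` at every tuple (all
six rows) and a spine reading pinned to `crGap₁₃V 2 (jc …) ρ n` on the live line ∕ `crOneTerm₁₃ 0` off it carrying `KeyedRelWeight ∧ KeyedShellWeight ∧ KeyedExtractionV ∧
KeyedCoreEdgeHolderD4V β · rr` — N21's and N27x's by V1's THEOREMS.  The registered pin (`crOfRecord₁₃V`) is the plan's and is untouched; nothing of Bałaban's proved. [bookkeeping] -/
theorem exists_gapPinned_faces_of_closeness (β : ℝ) (rr : RateReadingFn) (jc : CutReading) (δc : WidthLetter₁₃CoPH 2)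
    (hζm : ∀ (F : T4Family) (θ : Stage13HParams F 2), θ.Provisos₁₃CoPH F 2 → ((θ.ZhUnity F 2 ∧ θ.SlotsNondegenerate₁₃ F 2) ∧ LiveSel F θ) → θ.Admissible F 2 →
      ZetaMeasurable F 2 θ.ζ)
    (h0 : ∀ (F : T4Family) (θ : Stage13HParams F 2) (hP : θ.Provisos₁₃CoPH F 2) (g₀ : ℕ → ℝ) (os : List (ULoop F)) (K : ℕ), 0 ≤ δc F θ hP g₀ os K)
    (h16 : ∀ (F : T4Family) (θ : Stage13HParams F 2) (hP : θ.Provisos₁₃CoPH F 2) (g₀ : ℕ → ℝ) (os : List (ULoop F)) (K : ℕ), δc F θ hP g₀ os K ≤ 1 / 16)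
    (hs : ∀ (F : T4Family) (θ : Stage13HParams F 2) (hP : θ.Provisos₁₃CoPH F 2) (g₀ : ℕ → ℝ) (os : List (ULoop F)), Summable (δc F θ hP g₀ os))
    (h20 : ∀ (F : T4Family) (θ : Stage13HParams F 2) (hP : θ.Provisos₁₃CoPH F 2), ((θ.ZhUnity F 2 ∧ θ.SlotsNondegenerate₁₃ F 2) ∧ LiveSel F θ) → θ.Admissible F 2 →
      ∀ (g₀ : ℕ → ℝ) (os : List (ULoop F)) (ρ : ℕ → ℝ) (n : ℕ → ℕ),
        (∀ K, 0 ≤ ρ K) ∧ (∀ K, ρ K ≤ 1) ∧ Summable (fun K => 1 / ((n K : ℝ) + 1)) ∧ (∀ K, 2 * δc F θ hP g₀ os K ≤ ρ K) ∧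
          (∀ K, (1 : ℝ) / 2 ≤ (1 - ρ K) ^ (n K + 2)) ∧ (∀ K i, i ≤ n K + 2 → δc F θ hP g₀ os K ≤ (1 - ρ K) ^ i * ρ K) →
        ∃ W : ℕ → ℝ, RelWeightBound 1 (classSet₁₃ θ 0 g₀) (gapWeightA₁₃ θ hP 0 g₀ os ρ n) (gapWeightB₁₃ θ hP 0 g₀ os ρ n) (badClass₁₃ θ 0 g₀ (jc F θ hP g₀ os)) W)
    (h19 : ∀ (F : T4Family) (θ : Stage13HParams F 2) (h : θ.Provisos₁₃SepCoPH F 2) (v : Revision₁₃ F 2 θ h),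
      ((θ.ZhUnity F 2 ∧ θ.SlotsNondegenerate₁₃ F 2) ∧ LiveSel F θ) → θ.Admissible F 2 →
      B16.EndStatementBPrinted (datumOfRecord₁₃SepCoPHV F 2 θ h v).C → DagBinding.EndpointExistence (datumOfRecord₁₃SepCoPHV F 2 θ h v).C.toB12 →
        ForSmallCouplings (datumOfRecord₁₃SepCoPHV F 2 θ h v) fun g₀ => ∀ (os : List (ULoop F)) (ρ : ℕ → ℝ) (n : ℕ → ℕ),
          (∀ K, 0 ≤ ρ K) ∧ (∀ K, ρ K ≤ 1) ∧ Summable (fun K => 1 / ((n K : ℝ) + 1)) ∧ (∀ K, 2 * δc F θ h.toCore g₀ os K ≤ ρ K) ∧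
            (∀ K, (1 : ℝ) / 2 ≤ (1 - ρ K) ^ (n K + 2)) ∧ (∀ K i, i ≤ n K + 2 → δc F θ h.toCore g₀ os K ≤ (1 - ρ K) ^ i * ρ K) →
          PHolderD4 β (datumOfRecord₁₃SepCoPHV F 2 θ h v) (rr F θ h.toCore g₀ os) →
            letI : DecidableEq (Σ K, SiteSeqKey F (0 + K)) := Classical.decEq _
            ∃ δ : ℕ → ℝ, NE7.Core 1 (F.side ^ 4) (classSet₁₃ θ 0 g₀) (badClass₁₃ θ 0 g₀ (jc F θ h.toCore g₀ os))
              (gapCoreA₁₃ θ h.toCore 0 g₀ os ρ n) (gapCoreB₁₃ θ h.toCore 0 g₀ os ρ n) δ ∧ Summable δ)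
    (htarget : ∀ (F : T4Family) (θ : Stage13HParams F 2) (hP : θ.Provisos₁₃CoPH F 2), ((θ.ZhUnity F 2 ∧ θ.SlotsNondegenerate₁₃ F 2) ∧ ¬ LiveSel F θ) → θ.Admissible F 2 →
      ∀ (g₀ : ℕ → ℝ) (os : List (ULoop F)), PHolderD4 β (datumOfRecord₁₃CoPH F 2 θ hP) (rr F θ hP g₀ os) →
        ∃ δ : ℕ → ℝ, NE7.Target ((F.side : ℝ) ^ 4) 1 δ (fun K => T4GenFunBounds.schemeZ ((datumOfRecord₁₃CoPH F 2 θ hP).scheme g₀) os (0 + K))) :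
    ∃ (ρ : WidthLetter₁₃CoPH 2) (n : DepthLetter₁₃CoPH 2) (cr : SpineReading),
      (∀ (F : T4Family) (θ : Stage13HParams F 2) (hP : θ.Provisos₁₃CoPH F 2) (g₀ : ℕ → ℝ) (os : List (ULoop F)),
        (∀ K, 0 ≤ ρ F θ hP g₀ os K) ∧ (∀ K, ρ F θ hP g₀ os K ≤ 1) ∧ Summable (fun K => 1 / ((n F θ hP g₀ os K : ℝ) + 1)) ∧
        (∀ K, 2 * δc F θ hP g₀ os K ≤ ρ F θ hP g₀ os K) ∧ (∀ K, (1 : ℝ) / 2 ≤ (1 - ρ F θ hP g₀ os K) ^ (n F θ hP g₀ os K + 2)) ∧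
        (∀ K i, i ≤ n F θ hP g₀ os K + 2 → δc F θ hP g₀ os K ≤ (1 - ρ F θ hP g₀ os K) ^ i * ρ F θ hP g₀ os K)) ∧
      (∀ (F : T4Family) (θ : Stage13HParams F 2) (hP : θ.Provisos₁₃CoPH F 2) (g₀ : ℕ → ℝ) (os : List (ULoop F)),
        LiveSel F θ → cr F θ hP g₀ os = crGap₁₃V 2 (jc F θ hP g₀ os) ρ n F θ hP g₀ os) ∧
      (∀ (F : T4Family) (θ : Stage13HParams F 2) (hP : θ.Provisos₁₃CoPH F 2) (g₀ : ℕ → ℝ) (os : List (ULoop F)),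
        ¬ LiveSel F θ → cr F θ hP g₀ os = crOneTerm₁₃ 0 F θ hP g₀ os) ∧
      KeyedRelWeight cr ∧ KeyedShellWeight cr ∧ KeyedExtractionV cr ∧ KeyedCoreEdgeHolderD4V β cr rr := by
  obtain ⟨ρ, n, hc⟩ := exists_widthDepthLetters_of_summable (N := 2) δc h0 h16 hs
  have hρ : ∀ (F : T4Family) (θ : Stage13HParams F 2) (hP : θ.Provisos₁₃CoPH F 2) (g₀ : ℕ → ℝ) (os : List (ULoop F)) (K : ℕ),
      0 ≤ ρ F θ hP g₀ os K ∧ ρ F θ hP g₀ os K ≤ 1 := fun F θ hP g₀ os => (dialRows_of_compat (hc F θ hP g₀ os)).1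
  have hn : ∀ (F : T4Family) (θ : Stage13HParams F 2) (hP : θ.Provisos₁₃CoPH F 2) (g₀ : ℕ → ℝ) (os : List (ULoop F)),
      Summable (fun K => 1 / ((n F θ hP g₀ os K : ℝ) + 1)) := fun F θ hP g₀ os => (dialRows_of_compat (hc F θ hP g₀ os)).2
  obtain ⟨cr, hon, hoff⟩ := exists_reading_livePin (fun F θ hP g₀ os => crGap₁₃V 2 (jc F θ hP g₀ os) ρ n F θ hP g₀ os)
  refine ⟨ρ, n, cr, hc, hon, hoff, keyedRelWeight_of_gapPin_of_witness jc ρ n hon hoff (fun F θ hP hG hθ g₀ os => h20 F θ hP hG hθ g₀ os _ _ (hc F θ hP g₀ os)),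
    keyedShellWeight_of_gapPin jc ρ n hon hoff hζm hρ hn, keyedExtractionV_of_gapPin jc ρ n hon hoff hζm,
    keyedCoreEdgeHolderD4V_of_gapPin_of_witness jc ρ n hon hoff hζm β rr hρ hn (fun F θ h v hG hθ hB hE => ?_) htarget⟩
  exact ForSmallCouplings.mono (fun g₀ h' os hPr => h' os _ _ (hc F θ h.toCore g₀ os) hPr) (h19 F θ h v hG hθ hB hE)

/-- ★★ **A GAP-PINNED READING WITH ALL FOUR K5 FACES, FROM ONE CLOSENESS LETTER — N20 READ AT THE RECORD** (V4's transfer; + the persistence-policy row). [bookkeeping] -/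
theorem exists_gapPinned_faces_of_closeness_record (β : ℝ) (rr : RateReadingFn) (jc : CutReading) (δc : WidthLetter₁₃CoPH 2)
    (hζm : ∀ (F : T4Family) (θ : Stage13HParams F 2), θ.Provisos₁₃CoPH F 2 → ((θ.ZhUnity F 2 ∧ θ.SlotsNondegenerate₁₃ F 2) ∧ LiveSel F θ) → θ.Admissible F 2 →
      ZetaMeasurable F 2 θ.ζ)
    (h0 : ∀ (F : T4Family) (θ : Stage13HParams F 2) (hP : θ.Provisos₁₃CoPH F 2) (g₀ : ℕ → ℝ) (os : List (ULoop F)) (K : ℕ), 0 ≤ δc F θ hP g₀ os K)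
    (h16 : ∀ (F : T4Family) (θ : Stage13HParams F 2) (hP : θ.Provisos₁₃CoPH F 2) (g₀ : ℕ → ℝ) (os : List (ULoop F)) (K : ℕ), δc F θ hP g₀ os K ≤ 1 / 16)
    (hs : ∀ (F : T4Family) (θ : Stage13HParams F 2) (hP : θ.Provisos₁₃CoPH F 2) (g₀ : ℕ → ℝ) (os : List (ULoop F)), Summable (δc F θ hP g₀ os))
    (hj : ∀ (F : T4Family) (θ : Stage13HParams F 2) (hP : θ.Provisos₁₃CoPH F 2) (g₀ : ℕ → ℝ) (os : List (ULoop F)) (K : ℕ),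
      jc F θ hP g₀ os K < 0 + K ∨ jc F θ hP g₀ os K = 0)
    (h20 : ∀ (F : T4Family) (θ : Stage13HParams F 2) (hP : θ.Provisos₁₃CoPH F 2), ((θ.ZhUnity F 2 ∧ θ.SlotsNondegenerate₁₃ F 2) ∧ LiveSel F θ) → θ.Admissible F 2 →
      ∀ (g₀ : ℕ → ℝ) (os : List (ULoop F)),
        ∃ W : ℕ → ℝ, RelWeightBound 1 (classSet₁₃ θ 0 g₀) (weightA₁₃ θ hP 0 g₀ os) (weightB₁₃ θ hP 0 g₀ os) (badClass₁₃ θ 0 g₀ (jc F θ hP g₀ os)) W)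
    (h19 : ∀ (F : T4Family) (θ : Stage13HParams F 2) (h : θ.Provisos₁₃SepCoPH F 2) (v : Revision₁₃ F 2 θ h),
      ((θ.ZhUnity F 2 ∧ θ.SlotsNondegenerate₁₃ F 2) ∧ LiveSel F θ) → θ.Admissible F 2 →
      B16.EndStatementBPrinted (datumOfRecord₁₃SepCoPHV F 2 θ h v).C → DagBinding.EndpointExistence (datumOfRecord₁₃SepCoPHV F 2 θ h v).C.toB12 →
        ForSmallCouplings (datumOfRecord₁₃SepCoPHV F 2 θ h v) fun g₀ => ∀ (os : List (ULoop F)) (ρ : ℕ → ℝ) (n : ℕ → ℕ),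
          (∀ K, 0 ≤ ρ K) ∧ (∀ K, ρ K ≤ 1) ∧ Summable (fun K => 1 / ((n K : ℝ) + 1)) ∧ (∀ K, 2 * δc F θ h.toCore g₀ os K ≤ ρ K) ∧
            (∀ K, (1 : ℝ) / 2 ≤ (1 - ρ K) ^ (n K + 2)) ∧ (∀ K i, i ≤ n K + 2 → δc F θ h.toCore g₀ os K ≤ (1 - ρ K) ^ i * ρ K) →
          PHolderD4 β (datumOfRecord₁₃SepCoPHV F 2 θ h v) (rr F θ h.toCore g₀ os) →
            letI : DecidableEq (Σ K, SiteSeqKey F (0 + K)) := Classical.decEq _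
            ∃ δ : ℕ → ℝ, NE7.Core 1 (F.side ^ 4) (classSet₁₃ θ 0 g₀) (badClass₁₃ θ 0 g₀ (jc F θ h.toCore g₀ os))
              (gapCoreA₁₃ θ h.toCore 0 g₀ os ρ n) (gapCoreB₁₃ θ h.toCore 0 g₀ os ρ n) δ ∧ Summable δ)
    (htarget : ∀ (F : T4Family) (θ : Stage13HParams F 2) (hP : θ.Provisos₁₃CoPH F 2), ((θ.ZhUnity F 2 ∧ θ.SlotsNondegenerate₁₃ F 2) ∧ ¬ LiveSel F θ) → θ.Admissible F 2 →
      ∀ (g₀ : ℕ → ℝ) (os : List (ULoop F)), PHolderD4 β (datumOfRecord₁₃CoPH F 2 θ hP) (rr F θ hP g₀ os) →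
        ∃ δ : ℕ → ℝ, NE7.Target ((F.side : ℝ) ^ 4) 1 δ (fun K => T4GenFunBounds.schemeZ ((datumOfRecord₁₃CoPH F 2 θ hP).scheme g₀) os (0 + K))) :
    ∃ (ρ : WidthLetter₁₃CoPH 2) (n : DepthLetter₁₃CoPH 2) (cr : SpineReading),
      (∀ (F : T4Family) (θ : Stage13HParams F 2) (hP : θ.Provisos₁₃CoPH F 2) (g₀ : ℕ → ℝ) (os : List (ULoop F)),
        (∀ K, 0 ≤ ρ F θ hP g₀ os K) ∧ (∀ K, ρ F θ hP g₀ os K ≤ 1) ∧ Summable (fun K => 1 / ((n F θ hP g₀ os K : ℝ) + 1)) ∧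
        (∀ K, 2 * δc F θ hP g₀ os K ≤ ρ F θ hP g₀ os K) ∧ (∀ K, (1 : ℝ) / 2 ≤ (1 - ρ F θ hP g₀ os K) ^ (n F θ hP g₀ os K + 2)) ∧
        (∀ K i, i ≤ n F θ hP g₀ os K + 2 → δc F θ hP g₀ os K ≤ (1 - ρ F θ hP g₀ os K) ^ i * ρ F θ hP g₀ os K)) ∧
      (∀ (F : T4Family) (θ : Stage13HParams F 2) (hP : θ.Provisos₁₃CoPH F 2) (g₀ : ℕ → ℝ) (os : List (ULoop F)),
        LiveSel F θ → cr F θ hP g₀ os = crGap₁₃V 2 (jc F θ hP g₀ os) ρ n F θ hP g₀ os) ∧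
      (∀ (F : T4Family) (θ : Stage13HParams F 2) (hP : θ.Provisos₁₃CoPH F 2) (g₀ : ℕ → ℝ) (os : List (ULoop F)),
        ¬ LiveSel F θ → cr F θ hP g₀ os = crOneTerm₁₃ 0 F θ hP g₀ os) ∧
      KeyedRelWeight cr ∧ KeyedShellWeight cr ∧ KeyedExtractionV cr ∧ KeyedCoreEdgeHolderD4V β cr rr := by
  refine exists_gapPinned_faces_of_closeness β rr jc δc hζm h0 h16 hs (fun F θ hP hG hθ g₀ os ρ n _ => ?_) h19 htarget
  obtain ⟨W, hW⟩ := h20 F θ hP hG hθ g₀ os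
  exact ⟨W, (relWeightBound_gapCarriers_iff_record 0 θ hP g₀ os (EOfRecord₁₃ F 2 θ.toStage13Params) hG.2 (hζm F θ hP hG hθ) (jc F θ hP g₀ os)
    (hj F θ hP g₀ os) ρ n W).2 hW⟩

/-! ## §3 The fewest-binder edition: one closeness letter at the ZERO CUT (N20 by dag-n20-w2's theorem) -/

/-- ★★★ **K3⁸ ON THE GAPPED ROAD FROM ONE CLOSENESS LETTER AT THE ZERO CUT `jc ≡ 0` — NO N20 LINE.**  dag-n20-w2's `spineGivenEndpointR13SepCoPHV_of_gapRoad_cutZero` (N20's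
witness `W := 0` at the zero cut, where the bad class is every keyed class; N21 ∕ N27x by dag-n21-d's theorems) with the dials ∃-produced from `δc`.  Displayed: (H-ζ) on the
live line; the closeness letter's rows; K4; N19′ = the NE7 sandwich `e^{c−L⁴δ_K}·coreA ≤ coreB ≤ e^{c+L⁴δ_K}·coreA` on EVERY keyed class between the two runs' GAPPED cores, with
`Σ δ < ∞`, FOR EVERY local dial pair compatible with `δc` (slot-keyed, under the prefix and `PHolderD4 β`) — NE7 proper, NOT PRINTED for `d = 4`; node U5's Target off the live
line.  K3⁸ NOT claimed; nothing of Bałaban's proved. [bookkeeping] -/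
theorem spineGivenEndpointR13SepCoPHV_of_gapRoad_of_closeness_cutZero (β : ℝ) (rr : RateReadingFn) (δc : WidthLetter₁₃CoPH 2)
    (hζm : ∀ (F : T4Family) (θ : Stage13HParams F 2), θ.Provisos₁₃CoPH F 2 → ((θ.ZhUnity F 2 ∧ θ.SlotsNondegenerate₁₃ F 2) ∧ LiveSel F θ) → θ.Admissible F 2 →
      ZetaMeasurable F 2 θ.ζ)
    (h0 : ∀ (F : T4Family) (θ : Stage13HParams F 2) (hP : θ.Provisos₁₃CoPH F 2) (g₀ : ℕ → ℝ) (os : List (ULoop F)) (K : ℕ), 0 ≤ δc F θ hP g₀ os K)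
    (h16 : ∀ (F : T4Family) (θ : Stage13HParams F 2) (hP : θ.Provisos₁₃CoPH F 2) (g₀ : ℕ → ℝ) (os : List (ULoop F)) (K : ℕ), δc F θ hP g₀ os K ≤ 1 / 16)
    (hs : ∀ (F : T4Family) (θ : Stage13HParams F 2) (hP : θ.Provisos₁₃CoPH F 2) (g₀ : ℕ → ℝ) (os : List (ULoop F)), Summable (δc F θ hP g₀ os))
    (hr : KeyedRatesHolderD4V β rr)
    (h19 : ∀ (F : T4Family) (θ : Stage13HParams F 2) (h : θ.Provisos₁₃SepCoPH F 2) (v : Revision₁₃ F 2 θ h),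
      ((θ.ZhUnity F 2 ∧ θ.SlotsNondegenerate₁₃ F 2) ∧ LiveSel F θ) → θ.Admissible F 2 →
      B16.EndStatementBPrinted (datumOfRecord₁₃SepCoPHV F 2 θ h v).C → DagBinding.EndpointExistence (datumOfRecord₁₃SepCoPHV F 2 θ h v).C.toB12 →
        ForSmallCouplings (datumOfRecord₁₃SepCoPHV F 2 θ h v) fun g₀ => ∀ (os : List (ULoop F)) (ρ : ℕ → ℝ) (n : ℕ → ℕ),
          (∀ K, 0 ≤ ρ K) ∧ (∀ K, ρ K ≤ 1) ∧ Summable (fun K => 1 / ((n K : ℝ) + 1)) ∧ (∀ K, 2 * δc F θ h.toCore g₀ os K ≤ ρ K) ∧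
            (∀ K, (1 : ℝ) / 2 ≤ (1 - ρ K) ^ (n K + 2)) ∧ (∀ K i, i ≤ n K + 2 → δc F θ h.toCore g₀ os K ≤ (1 - ρ K) ^ i * ρ K) →
          PHolderD4 β (datumOfRecord₁₃SepCoPHV F 2 θ h v) (rr F θ h.toCore g₀ os) →
            ∃ δ : ℕ → ℝ, (∀ K : ℕ, ∃ c : ℝ, ∀ t : ℝ, |t| ≤ 1 → ∀ x ∈ classSet₁₃ θ 0 g₀ K,
              Real.exp (c - F.side ^ 4 * δ K) * gapCoreA₁₃ θ h.toCore 0 g₀ os ρ n K t x ≤ gapCoreB₁₃ θ h.toCore 0 g₀ os ρ n K t x ∧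
                gapCoreB₁₃ θ h.toCore 0 g₀ os ρ n K t x ≤ Real.exp (c + F.side ^ 4 * δ K) * gapCoreA₁₃ θ h.toCore 0 g₀ os ρ n K t x) ∧ Summable δ)
    (htarget : ∀ (F : T4Family) (θ : Stage13HParams F 2) (hP : θ.Provisos₁₃CoPH F 2), ((θ.ZhUnity F 2 ∧ θ.SlotsNondegenerate₁₃ F 2) ∧ ¬ LiveSel F θ) → θ.Admissible F 2 →
      ∀ (g₀ : ℕ → ℝ) (os : List (ULoop F)), PHolderD4 β (datumOfRecord₁₃CoPH F 2 θ hP) (rr F θ hP g₀ os) →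
        ∃ δ : ℕ → ℝ, NE7.Target ((F.side : ℝ) ^ 4) 1 δ (fun K => T4GenFunBounds.schemeZ ((datumOfRecord₁₃CoPH F 2 θ hP).scheme g₀) os (0 + K))) :
    Summit.QuantumFields.YangMills.Theses.BalabanUVNodes.SpineGivenEndpointR13SepCoPHV := by
  obtain ⟨ρ, n, hc⟩ := exists_widthDepthLetters_of_summable (N := 2) δc h0 h16 hs
  refine spineGivenEndpointR13SepCoPHV_of_gapRoad_cutZero β rr ρ n hζm (fun F θ hP g₀ os => (dialRows_of_compat (hc F θ hP g₀ os)).1)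
    (fun F θ hP g₀ os => (dialRows_of_compat (hc F θ hP g₀ os)).2) hr (fun F θ h v hG hθ hB hE => ?_) htarget
  exact ForSmallCouplings.mono (fun g₀ h' os hPr => h' os _ _ (hc F θ h.toCore g₀ os) hPr) (h19 F θ h v hG hθ hB hE)

end Summit.QuantumFields.YangMills.Theorems.N21GappedRoadK3V6KnitOfCloseness

end
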